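import Summits.Ventures.PercRepro.RankLevelSetPrimeCover

/-!
# PercRepro — the points that share a cover side are coloops of the side's complement (p9, gen 25)

For a `G`-closed set `H` (a relative hyperplane: `r(G) ≤ r(H) + 1`) and a point `z ∈ G ∖ H` whose cover has `H` as a
side, the other side contains `(G ∖ H) ∖ {z}`, so `z ∉ cl((G ∖ H) ∖ {z})`: `z` is a coloop of `Z := G ∖ H`.  Hence the set
`Z₀` of all such points is INDEPENDENT and the rest of `Z` has rank `≤ r(Z) − |Z₀|`:
`|G| = |H| + |Z₀| + |Z ∖ Z₀|` with `r(Z ∖ Z₀) + |Z₀| ≤ r(G)` — the coloop decomposition of a cocircuit of the `e`-free core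
(proofs/P9-FLATBOUND-g25.md §4(b)).  With the flat bounds `f` of the tree this reads `|G| ≤ |H| + c + f(r − c)`,
`c = |Z₀|`; at `|G| = 16`, `r = 5`, `|H| ≤ 9` it forces `c ≤ 2`.

* **`notMem_closure_sdiff_of_cover_side`** — `z ∉ cl(Z ∖ {z})` when `H` is a side of a cover of `z`;
* **`indep_of_forall_cover_side`** — a set of such points is independent;
* **`eRk_sdiff_add_ncard_le`** — `r(Z ∖ Z₀) + |Z₀| ≤ r(Z)` for an independent `Z₀ ⊆ Z` of coloops of `Z`.
Axioms: standard.
-/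

open scoped Matroid

namespace PercRepro

namespace ThmN

open Set

variable {α : Type}

/-- A point `z ∉ H` whose cover has `H` as a side is not in the closure of `(G ∖ H) ∖ {z}`. -/
theorem notMem_closure_sdiff_of_cover_side (M : Matroid α) {G H H₂ : Set α} {z : α}
    (hH₂ : GClosed M G H₂) (hz : z ∈ G) (hzH₂ : z ∉ H₂) (hcov : G \ {z} ⊆ H ∪ H₂) :
    z ∉ M.closure ((G \ H) \ {z}) := by
  intro h
  have hsub : (G \ H) \ {z} ⊆ H₂ := by
    intro y hy
    rcases hcov ⟨hy.1.1, hy.2⟩ with h' | h'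
    · exact absurd h' hy.1.2
    · exact h'
  exact notMem_closure_of_gclosed hH₂ hz hzH₂ (M.closure_subset_closure hsub h)

/-- **Shared sides give an independent set**: if every `z ∈ Z₀ ⊆ G ∖ H` has a cover with side `H`, then `Z₀` is
independent. -/
theorem indep_of_forall_cover_side (M : Matroid α) [M.Finite] {G H Z₀ : Set α} (hG : G ⊆ M.E)
    (hZ₀ : Z₀ ⊆ G \ H)
    (hside : ∀ z ∈ Z₀, ∃ H₂ : Set α, GClosed M G H₂ ∧ z ∉ H₂ ∧ G \ {z} ⊆ H ∪ H₂) : M.Indep Z₀ := by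
  have hZE : Z₀ ⊆ M.E := (hZ₀.trans Set.sdiff_subset).trans hG
  rw [Matroid.indep_iff_forall_notMem_closure_sdiff hZE]
  intro z hz h
  obtain ⟨H₂, hH₂, hzH₂, hcov⟩ := hside z hz
  have hzG : z ∈ G := (hZ₀ hz).1
  have hmono : Z₀ \ {z} ⊆ (G \ H) \ {z} := fun y hy => ⟨hZ₀ hy.1, hy.2⟩
  exact notMem_closure_sdiff_of_cover_side M hH₂ hzG hzH₂ hcov (M.closure_subset_closure hmono h)

/-- **The coloop decomposition**: if `Z₀ ⊆ Z` is independent and no `z ∈ Z₀` lies in `cl(Z ∖ {z})`, then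
`r(Z ∖ Z₀) + |Z₀| ≤ r(Z)` (finite ranks). -/
theorem eRk_sdiff_add_ncard_le (M : Matroid α) [M.Finite] {Z Z₀ : Set α} (hZ : Z ⊆ M.E) (hZ₀ : Z₀ ⊆ Z)
    (hcol : ∀ z ∈ Z₀, z ∉ M.closure (Z \ {z})) : M.eRk (Z \ Z₀) + Z₀.ncard ≤ M.eRk Z := by
  have hZfin : Z.Finite := M.ground_finite.subset hZ
  have hZ₀fin : Z₀.Finite := hZfin.subset hZ₀
  -- induction on the finite set `Z₀`
  revert hZ₀ hcol
  refine hZ₀fin.induction_on_subset Z₀ ?_ ?_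
  · intro _ _
    simp
  · intro z S hzZ₀ hS hzS ih hSZ hcolS
    have hSZ' : S ⊆ Z := (Set.subset_insert z S).trans hSZ
    have hcolS' : ∀ y ∈ S, y ∉ M.closure (Z \ {y}) := fun y hy => hcolS y (Set.mem_insert_of_mem z hy)
    have ih' := ih hSZ' hcolS'
    have hzZ : z ∈ Z := hSZ (Set.mem_insert z S)
    -- `z ∉ cl((Z ∖ S) ∖ {z})`, so removing `z` from `Z ∖ S` drops the rank
    have hzcl : z ∉ M.closure ((Z \ S) \ {z}) := by
      intro h
      exact hcolS z (Set.mem_insert z S)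
        (M.closure_subset_closure (fun y hy => ⟨hy.1.1, hy.2⟩ : (Z \ S) \ {z} ⊆ Z \ {z}) h)
    have hsplit : Z \ S = insert z ((Z \ S) \ {z}) := by
      ext y
      constructor
      · intro hy
        by_cases hyz : y = z
        · exact Or.inl hyz
        · exact Or.inr ⟨hy, hyz⟩
      · rintro (rfl | hy)
        · exact ⟨hzZ, hzS⟩
        · exact hy.1
    have hstep : M.eRk (Z \ S) = M.eRk ((Z \ S) \ {z}) + 1 := by
      have h1 : M.eRk (insert z ((Z \ S) \ {z})) = M.eRk ((Z \ S) \ {z}) + 1 :=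
        Matroid.eRk_insert_eq_add_one (Set.mem_sdiff_of_mem (hZ hzZ) hzcl)
      rw [← hsplit] at h1
      exact h1
    have hset : Z \ insert z S = (Z \ S) \ {z} := by
      ext y; simp only [Set.mem_sdiff, Set.mem_insert_iff, Set.mem_singleton_iff, not_or]; tauto
    rw [hset, Set.ncard_insert_of_notMem hzS (hZ₀fin.subset hS)]
    have : M.eRk ((Z \ S) \ {z}) + 1 + (S.ncard : ℕ∞) ≤ M.eRk Z := by
      rw [← hstep]; exact ih'
    push_cast
    calc M.eRk ((Z \ S) \ {z}) + ((S.ncard : ℕ∞) + 1) = M.eRk ((Z \ S) \ {z}) + 1 + (S.ncard : ℕ∞) := by ring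
      _ ≤ M.eRk Z := this

end ThmN

end PercRepro
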